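import Summits.CriticalPhenomena.PercolationContinuityZ3.Theorems.PercNearOneGluingNoHeavyLowerTailSahiCombPrincipalCoSunflower
import Summits.CriticalPhenomena.PercolationContinuityZ3.Theorems.PercNearOneGluingNoHeavyLowerTailSahiCombConjunctThree

/-!
# The comb (tensor-Bernstein) hierarchy for Sahi's `E_k`: (M⁺-3) for the PRINCIPAL CO-SUNFLOWER PADDED by an independent
# OR-system or AND-system

Support file (crux `NoHeavyLowerTail`, stmt-CriticalPhenomena-4575; cell `prim-masterthm`, seat P1, gens 21–22; memo
`run/shared/lean/prim/prim-masterthm/FROM-prim-masterthm-p1-g21-PRODUCT-FORM-AND-PRINCIPAL-CLASS.md` §2.4).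

THE POINT.  `…SahiCombPrincipalCoSunflower` proves (M⁺-3) (comb positivity of `E_3` at multidegree `3`) for the co-sunflower
`(⋃_{j ≠ k} ↑b_j)_k` of any three principal up-sets.  Seat P3's order-3 closure theorems (`combPos_sahiE_three_union_or` of
`…SahiCombDisjunctThreeComb`, `combPos_sahiE_three_inter_and` of `…SahiCombConjunctThree`) say that OR-ing, resp. AND-ing, an
independent coordinate system `S_k` into member `k` preserves (M⁺-3) when every member ignores every coordinate of every `S_k`.
Composing the two gives the padded principal classes (the ten-coin template of the memo, now without a certificate):
* `combPos_sahiE_three_principal_or` — `((⋃_{j ≠ k} ↑b_j) ∪ {ω | ω ∩ S_k ≠ ∅})_k` is comb-positive at multidegree `3`;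
* `combPos_sahiE_three_principal_and` — `((⋃_{j ≠ k} ↑b_j) ∩ ↑S_k)_k` is comb-positive at multidegree `3`;
* law-level shadows `sahiE_three_nonneg_principal_or`, `sahiE_three_nonneg_principal_and` (`E_3 ≥ 0` at every product measure),
for all `b, S : Fin 3 → Finset ι` with `b_j` disjoint from `S_k` for all `j, k`.
HONEST FRAMING: a proved stratum of the co-sunflower class law; nothing here asserts (M⁺-3) or `C_3` in general. [this work]
-/

noncomputable section

open scoped Classical

namespace Summit.CriticalPhenomena.PercolationContinuityZ3.Theorems

namespace SahiCombVenn

open Finset Function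
open Literature.Combinatorics.Sahi2008
open Literature.Probability.Percolation.DecisionTree (ind ind_of_mem ind_of_not_mem ind_nonneg)
open SahiComb SahiCombDisjunct SahiCombConjunct

variable {ι : Type} [Fintype ι]

omit [Fintype ι] in
/-- The co-sunflower members of three principal up-sets, as an explicit `Fin 3`-family of unions of two cylinders. [this work] -/
theorem coPrincipal_eq_vec (b : Fin 3 → Finset ι) (k : Fin 3) :
    (⋃ (j : Fin 3) (_ : j ≠ k), {ω : Set ι | (↑(b j) : Set ι) ⊆ ω}) =
      (![{ω : Set ι | (↑(b 1) : Set ι) ⊆ ω} ∪ {ω | (↑(b 2) : Set ι) ⊆ ω}, {ω : Set ι | (↑(b 0) : Set ι) ⊆ ω} ∪ {ω | (↑(b 2) : Set ι) ⊆ ω},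
        {ω : Set ι | (↑(b 0) : Set ι) ⊆ ω} ∪ {ω | (↑(b 1) : Set ι) ⊆ ω}] : Fin 3 → Set (Set ι)) k := by
  ext ω
  simp only [Set.mem_iUnion, exists_prop, Fin.exists_fin_succ, Fin.exists_fin_zero, or_false, Set.mem_setOf_eq]
  fin_cases k <;> simp

omit [Fintype ι] in
/-- The members are increasing. [folklore] -/
theorem isUpperSet_coPrincipal' (b : Fin 3 → Finset ι) (k : Fin 3) :
    IsUpperSet (⋃ (j : Fin 3) (_ : j ≠ k), {ω : Set ι | (↑(b j) : Set ι) ⊆ ω}) := by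
  intro ω ω' hle hω
  simp only [Set.mem_iUnion, Set.mem_setOf_eq, exists_prop] at hω ⊢
  obtain ⟨j, hj, hsub⟩ := hω
  exact ⟨j, hj, hsub.trans hle⟩

omit [Fintype ι] in
/-- The members ignore every coordinate outside the generators. [this work] -/
theorem secAt_coPrincipal_of_notMem (b : Fin 3 → Finset ι) {e : ι} (he : ∀ j, e ∉ b j) (bb : Bool) (k : Fin 3) :
    secAt e bb (⋃ (j : Fin 3) (_ : j ≠ k), {ω : Set ι | (↑(b j) : Set ι) ⊆ ω}) = ⋃ (j : Fin 3) (_ : j ≠ k), {ω : Set ι | (↑(b j) : Set ι) ⊆ ω} := by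
  rw [coPrincipal_eq_vec]
  fin_cases k <;>
    simp only [Fin.zero_eta, Fin.mk_one, Fin.reduceFinMk, Matrix.cons_val_zero, Matrix.cons_val_one, Matrix.cons_val,
      secAt_union, secAt_cylinder_of_notMem e _ (he _)]

/-- **(M⁺-3) for the principal co-sunflower padded by an independent OR-system**: for `b_j` and coordinate sets `S_k` disjoint from every `b_j`,
the triple `((⋃_{j≠k} ↑b_j) ∪ {ω | ω ∩ S_k ≠ ∅})_k` has `E_3` comb-positive at multidegree `3`. [this work] -/
theorem combPos_sahiE_three_principal_or (b S : Fin 3 → Finset ι) (hbS : ∀ j k, Disjoint (b j) (S k)) :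
    CombPos (fun _ : ι => 3) (fun q => sahiE (bernoulliWeight q) 3
      (fun k => ind ((⋃ (j : Fin 3) (_ : j ≠ k), {ω : Set ι | (↑(b j) : Set ι) ⊆ ω}) ∪ {ω : Set ι | ∃ i ∈ S k, i ∈ ω}))) := by
  have he : ∀ (j k : Fin 3), ∀ e ∈ S k, ∀ bb : Bool,
      secAt e bb (⋃ (l : Fin 3) (_ : l ≠ j), {ω : Set ι | (↑(b l) : Set ι) ⊆ ω}) = ⋃ (l : Fin 3) (_ : l ≠ j), {ω : Set ι | (↑(b l) : Set ι) ⊆ ω} :=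
    fun j k e heS bb => secAt_coPrincipal_of_notMem b (fun l hel => Finset.disjoint_left.1 (hbS l k) hel heS) bb j
  exact combPos_sahiE_three_union_or _ (isUpperSet_coPrincipal' b) S he (combPos_sahiE_three_principal b)

/-- **(M⁺-3) for the principal co-sunflower padded by an independent AND-system**: `((⋃_{j≠k} ↑b_j) ∩ ↑S_k)_k` is comb-positive for `S_k` disjoint
from every `b_j`. [this work] -/
theorem combPos_sahiE_three_principal_and (b S : Fin 3 → Finset ι) (hbS : ∀ j k, Disjoint (b j) (S k)) :
    CombPos (fun _ : ι => 3) (fun q => sahiE (bernoulliWeight q) 3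
      (fun k => ind ((⋃ (j : Fin 3) (_ : j ≠ k), {ω : Set ι | (↑(b j) : Set ι) ⊆ ω}) ∩ {ω : Set ι | (↑(S k) : Set ι) ⊆ ω}))) := by
  have he : ∀ (j k : Fin 3), ∀ e ∈ S k, ∀ bb : Bool,
      secAt e bb (⋃ (l : Fin 3) (_ : l ≠ j), {ω : Set ι | (↑(b l) : Set ι) ⊆ ω}) = ⋃ (l : Fin 3) (_ : l ≠ j), {ω : Set ι | (↑(b l) : Set ι) ⊆ ω} :=
    fun j k e heS bb => secAt_coPrincipal_of_notMem b (fun l hel => Finset.disjoint_left.1 (hbS l k) hel heS) bb j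
  exact combPos_sahiE_three_inter_and _ (isUpperSet_coPrincipal' b) S he (combPos_sahiE_three_principal b)

/-- Law-level shadow: `E_3 ≥ 0` for the OR-padded principal co-sunflower at every product measure. [this work] -/
theorem sahiE_three_nonneg_principal_or (q : ι → unitInterval) (b S : Fin 3 → Finset ι) (hbS : ∀ j k, Disjoint (b j) (S k)) :
    0 ≤ sahiE (bernoulliWeight q) 3
      (fun k => ind ((⋃ (j : Fin 3) (_ : j ≠ k), {ω : Set ι | (↑(b j) : Set ι) ⊆ ω}) ∪ {ω : Set ι | ∃ i ∈ S k, i ∈ ω})) :=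
  (combPos_sahiE_three_principal_or b S hbS).nonneg q

/-- Law-level shadow: `E_3 ≥ 0` for the AND-padded principal co-sunflower at every product measure. [this work] -/
theorem sahiE_three_nonneg_principal_and (q : ι → unitInterval) (b S : Fin 3 → Finset ι) (hbS : ∀ j k, Disjoint (b j) (S k)) :
    0 ≤ sahiE (bernoulliWeight q) 3
      (fun k => ind ((⋃ (j : Fin 3) (_ : j ≠ k), {ω : Set ι | (↑(b j) : Set ι) ⊆ ω}) ∩ {ω : Set ι | (↑(S k) : Set ι) ⊆ ω})) :=
  (combPos_sahiE_three_principal_and b S hbS).nonneg q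

end SahiCombVenn


end Summit.CriticalPhenomena.PercolationContinuityZ3.Theorems

end
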